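import Mathlib
import Literature.Analysis.FluidPDE.NormalisedPressureDifferenceMixed
import Literature.Analysis.FluidPDE.NormalisedPressureAffine
import Literature.Analysis.FluidPDE.PressureRepresentation
import Literature.Analysis.FluidPDE.NSSuitableESSProofs

/-!
# Route PlaneEnergyCeiling · crux `PlanarEnergyAPriori` — the `L^{4/3}` bound for the pressure gradient

Helper file for the crux item stmt-NavierStokesRegularity-16855 (`PlanarEnergyAPriori`), landed
`--supports` that item: the third input of the FLUX VARIATION BOUND (strategist census gen 1,
A-S6 (F1)) — the one Calderón–Zygmund input, there called "the Riesz `L^{4/3}` bound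
(RRS2016 Lemma 5.1 (5.8))". It is PROVED here from the tree's `L^r` bound for the DIFFERENCE of
two Riesz-transform pressures with mixed exponents
(`NormalisedPressureDifferenceMixed.exists_normalisedPressure_sub_memLp`, itself from the tree's
Calderón–Zygmund theory) by DIFFERENCE QUOTIENTS: translation covariance of `p̃`
(`normalisedPressure_comp_affine`) gives `p̃[w](· + he) − p̃[w] = p̃[w(· + he)] − p̃[w]`, whose
`L^{4/3}` norm is `≤ C (‖|w_h − w| |w|‖_{4/3} + ‖|w_h − w|²‖_{4/3}) ≤ 3C ‖w‖₄ ‖w_h − w‖₂` (Hölder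
`L² × L⁴ → L^{4/3}`), and `‖w_h − w‖₂ ≤ h ‖Dw‖₂` (fundamental theorem along segments, Cauchy–Schwarz,
Tonelli, translation invariance); Fatou as `h ↓ 0` (`p̃[w]` is `C²` for `w ∈ C⁴ ∩ L²`, being the
pressure potential of `PressureRepresentation`).

* `lintegral_enorm_sub_translate_sq_le` / `eLpNorm_sub_translate_le` — `‖w(a + ·) − w‖₂ ≤ ‖a‖ ‖Dw‖₂`
  for `C¹` maps;
* `eLpNorm_normalisedPressure_translate_sub_le` — the difference bound at a fixed step;
* `exists_eLpNorm_fderiv_normalisedPressure_apply_le` — `‖∂ₑ p̃[w]‖_{4/3} ≤ K ‖w‖₄ ‖Dw‖₂`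
  (`‖e‖ ≤ 1`), and the registered closed form for the full derivative,
  `eLpNorm_fderiv_normalisedPressure_le` : `‖D p̃[w]‖_{4/3} ≤ K ‖w‖₄ ‖Dw‖₂`.
Folklore consequence of Stein 1970, Ch. II §4.2 Thm 3 (Robinson–Rodrigo–Sadowski 2016, Lemma 5.1).
-/

noncomputable section

-- single-conjunct summit: `Summit.<Summit>.<Problem>` repeats the name by the D-0017 layout
set_option linter.dupNamespace false

namespace Summit.NavierStokesRegularity.NavierStokesRegularity.Theorems.PlanarEnergyAPriori

open MeasureTheory Set Filter Topology Function
open scoped ENNReal NNReal RealInnerProductSpace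
open Literature.Analysis.FluidPDE

/-! ### Translation estimate `‖w(a + ·) − w‖₂ ≤ ‖a‖ ‖Dw‖₂` -/

section Translate

variable {F : Type*} [NormedAddCommGroup F] [NormedSpace ℝ F] [CompleteSpace F]

/-- Pointwise: `‖w(a + y) − w(y)‖ ≤ ∫₀¹ ‖Dw(y + s a)‖ ‖a‖ ds` (in `ℝ≥0∞`) for a `C¹` map
(fundamental theorem of calculus along the segment). -/
theorem enorm_sub_translate_le {w : EuclideanSpace ℝ (Fin 3) → F} (hw : ContDiff ℝ 1 w)
    (a y : EuclideanSpace ℝ (Fin 3)) :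
    ‖w (a + y) - w y‖ₑ ≤ ∫⁻ s in Ioc (0 : ℝ) 1, ‖fderiv ℝ w (y + s • a)‖ₑ * ‖a‖ₑ := by
  have hdiff : Differentiable ℝ w := hw.differentiable one_ne_zero
  -- the path and its derivative
  have hγ : ∀ s : ℝ, HasDerivAt (fun s : ℝ => w (y + s • a)) (fderiv ℝ w (y + s • a) a) s := by
    intro s
    have hl : HasDerivAt (fun s : ℝ => y + s • a) a s := by
      simpa using ((hasDerivAt_id s).smul_const a).const_add y
    exact (hdiff _).hasFDerivAt.comp_hasDerivAt s hl
  have hcont : Continuous fun s : ℝ => fderiv ℝ w (y + s • a) a :=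
    ((hw.continuous_fderiv one_ne_zero).comp (by fun_prop)).clm_apply continuous_const
  have hFTC := intervalIntegral.integral_eq_sub_of_hasDerivAt (a := (0 : ℝ)) (b := 1)
    (fun s _ => hγ s) (hcont.intervalIntegrable 0 1)
  simp only [zero_smul, add_zero, one_smul] at hFTC
  rw [add_comm a y, ← hFTC, intervalIntegral.integral_of_le zero_le_one]
  calc ‖∫ s in Ioc (0 : ℝ) 1, fderiv ℝ w (y + s • a) a‖ₑ
      ≤ ∫⁻ s in Ioc (0 : ℝ) 1, ‖fderiv ℝ w (y + s • a) a‖ₑ := enorm_integral_le_lintegral_enorm _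
    _ ≤ ∫⁻ s in Ioc (0 : ℝ) 1, ‖fderiv ℝ w (y + s • a)‖ₑ * ‖a‖ₑ := by
        refine lintegral_mono fun s => ?_
        rw [← ofReal_norm, ← ofReal_norm, ← ofReal_norm, ← ENNReal.ofReal_mul (norm_nonneg _)]
        exact ENNReal.ofReal_le_ofReal (ContinuousLinearMap.le_opNorm _ _)

/-- Cauchy–Schwarz on the unit interval: `(∫_{(0,1]} g)² ≤ ∫_{(0,1]} g²` for measurable
`g : ℝ → ℝ≥0∞`. -/
theorem lintegral_Ioc_sq_le {g : ℝ → ℝ≥0∞} (hg : Measurable g) :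
    (∫⁻ s in Ioc (0 : ℝ) 1, g s) ^ 2 ≤ ∫⁻ s in Ioc (0 : ℝ) 1, g s ^ 2 := by
  have hH := ENNReal.lintegral_mul_le_Lp_mul_Lq (volume.restrict (Ioc (0 : ℝ) 1))
    Real.HolderConjugate.two_two hg.aemeasurable (g := fun _ => (1 : ℝ≥0∞)) aemeasurable_const
  simp only [Pi.mul_apply, mul_one, lintegral_const, Measure.restrict_apply MeasurableSet.univ,
    univ_inter, Real.volume_Ioc, sub_zero, ENNReal.ofReal_one, ENNReal.rpow_two, one_pow, ENNReal.one_rpow] at hH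
  calc (∫⁻ s in Ioc (0 : ℝ) 1, g s) ^ 2
      ≤ ((∫⁻ s in Ioc (0 : ℝ) 1, g s ^ 2) ^ (1 / (2 : ℝ))) ^ 2 := by gcongr
    _ = ∫⁻ s in Ioc (0 : ℝ) 1, g s ^ 2 := by
        rw [← ENNReal.rpow_two, ← ENNReal.rpow_mul]; norm_num

/-- **The squared translation estimate**: `∫ ‖w(a + y) − w(y)‖² dy ≤ ‖a‖² ∫ ‖Dw‖²` for a `C¹` map
`w : ℝ³ → F` (segment FTC, Cauchy–Schwarz on the segment, Tonelli, translation invariance of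
Lebesgue measure). [folklore] -/
theorem lintegral_enorm_sub_translate_sq_le {w : EuclideanSpace ℝ (Fin 3) → F} (hw : ContDiff ℝ 1 w)
    (a : EuclideanSpace ℝ (Fin 3)) :
    ∫⁻ y, ‖w (a + y) - w y‖ₑ ^ 2 ≤ ‖a‖ₑ ^ 2 * ∫⁻ x, ‖fderiv ℝ w x‖ₑ ^ 2 := by
  have hDc : Continuous fun x => fderiv ℝ w x := hw.continuous_fderiv one_ne_zero
  have hmD : Measurable fun x => ‖fderiv ℝ w x‖ₑ ^ 2 := (continuous_enorm.comp hDc).measurable.pow_const 2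
  -- the two-variable density `(y, s) ↦ ‖Dw(y + s a)‖²` is measurable
  have hm2 : Measurable fun z : EuclideanSpace ℝ (Fin 3) × ℝ => ‖fderiv ℝ w (z.1 + z.2 • a)‖ₑ ^ 2 := by
    have hc : Continuous fun z : EuclideanSpace ℝ (Fin 3) × ℝ => z.1 + z.2 • a := by fun_prop
    exact ((continuous_enorm.comp (hDc.comp hc)).measurable).pow_const 2
  -- pointwise bound, squared
  have hpt : ∀ y, ‖w (a + y) - w y‖ₑ ^ 2 ≤ ‖a‖ₑ ^ 2 * ∫⁻ s in Ioc (0 : ℝ) 1, ‖fderiv ℝ w (y + s • a)‖ₑ ^ 2 := by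
    intro y
    have hmy : Measurable fun s : ℝ => ‖fderiv ℝ w (y + s • a)‖ₑ :=
      (continuous_enorm.comp (hDc.comp (by fun_prop))).measurable
    calc ‖w (a + y) - w y‖ₑ ^ 2
        ≤ (∫⁻ s in Ioc (0 : ℝ) 1, ‖fderiv ℝ w (y + s • a)‖ₑ * ‖a‖ₑ) ^ 2 := by
          gcongr; exact enorm_sub_translate_le hw a y
      _ = (‖a‖ₑ * ∫⁻ s in Ioc (0 : ℝ) 1, ‖fderiv ℝ w (y + s • a)‖ₑ) ^ 2 := by
          rw [lintegral_mul_const _ hmy, mul_comm]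
      _ = ‖a‖ₑ ^ 2 * (∫⁻ s in Ioc (0 : ℝ) 1, ‖fderiv ℝ w (y + s • a)‖ₑ) ^ 2 := by rw [mul_pow]
      _ ≤ ‖a‖ₑ ^ 2 * ∫⁻ s in Ioc (0 : ℝ) 1, ‖fderiv ℝ w (y + s • a)‖ₑ ^ 2 := by
          gcongr; exact lintegral_Ioc_sq_le hmy
  -- integrate and swap
  calc ∫⁻ y, ‖w (a + y) - w y‖ₑ ^ 2
      ≤ ∫⁻ y, ‖a‖ₑ ^ 2 * ∫⁻ s in Ioc (0 : ℝ) 1, ‖fderiv ℝ w (y + s • a)‖ₑ ^ 2 := lintegral_mono hpt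
    _ = ‖a‖ₑ ^ 2 * ∫⁻ y, ∫⁻ s in Ioc (0 : ℝ) 1, ‖fderiv ℝ w (y + s • a)‖ₑ ^ 2 := by
        rw [lintegral_const_mul'' _ (hm2.lintegral_prod_right'.aemeasurable)]
    _ = ‖a‖ₑ ^ 2 * ∫⁻ s in Ioc (0 : ℝ) 1, ∫⁻ y, ‖fderiv ℝ w (y + s • a)‖ₑ ^ 2 := by
        rw [lintegral_lintegral_swap (hm2.aemeasurable)]
    _ = ‖a‖ₑ ^ 2 * ∫⁻ s in Ioc (0 : ℝ) 1, ∫⁻ x, ‖fderiv ℝ w x‖ₑ ^ 2 := by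
        congr 1
        refine lintegral_congr fun s => ?_
        exact lintegral_add_right_eq_self (fun x => ‖fderiv ℝ w x‖ₑ ^ 2) (s • a)
    _ = ‖a‖ₑ ^ 2 * ∫⁻ x, ‖fderiv ℝ w x‖ₑ ^ 2 := by
        rw [lintegral_const, Measure.restrict_apply MeasurableSet.univ, univ_inter, Real.volume_Ioc]
        simp

/-- **The translation estimate in `L²`**: `‖w(a + ·) − w‖_{L²} ≤ ‖a‖ · ‖Dw‖_{L²}` for a `C¹` map
`w : ℝ³ → F`. [folklore] -/
theorem eLpNorm_sub_translate_le {w : EuclideanSpace ℝ (Fin 3) → F} (hw : ContDiff ℝ 1 w)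
    (a : EuclideanSpace ℝ (Fin 3)) :
    eLpNorm (fun y => w (a + y) - w y) 2 volume ≤ ‖a‖ₑ * eLpNorm (fun x => fderiv ℝ w x) 2 volume := by
  have h2 : ((2 : ℝ≥0∞)).toReal = 2 := by norm_num
  rw [eLpNorm_eq_lintegral_rpow_enorm_toReal two_ne_zero ENNReal.ofNat_ne_top,
    eLpNorm_eq_lintegral_rpow_enorm_toReal two_ne_zero ENNReal.ofNat_ne_top, h2]
  simp only [ENNReal.rpow_two, one_div]
  have h := lintegral_enorm_sub_translate_sq_le hw a
  calc (∫⁻ y, ‖w (a + y) - w y‖ₑ ^ 2) ^ (2 : ℝ)⁻¹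
      ≤ (‖a‖ₑ ^ 2 * ∫⁻ x, ‖fderiv ℝ w x‖ₑ ^ 2) ^ (2 : ℝ)⁻¹ := by gcongr
    _ = ‖a‖ₑ * (∫⁻ x, ‖fderiv ℝ w x‖ₑ ^ 2) ^ (2 : ℝ)⁻¹ := by
        rw [ENNReal.mul_rpow_of_nonneg _ _ (by norm_num), ← ENNReal.rpow_two, ← ENNReal.rpow_mul]
        norm_num

end Translate

/-! ### The difference bound at a fixed step -/

section Pressure

/-- `1 < 4/3 < ∞` in `ℝ≥0∞`. -/
theorem one_lt_fourThirds : (1 : ℝ≥0∞) < 4 / 3 ∧ (4 / 3 : ℝ≥0∞) < ⊤ := by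
  refine ⟨?_, ENNReal.div_lt_top (by norm_num) (by norm_num)⟩
  rw [ENNReal.lt_div_iff_mul_lt (Or.inl (by norm_num)) (Or.inl (by norm_num))]
  norm_num

/-- Hölder `L² × L⁴ → L^{4/3}` for a product of norms: `‖|f| |g|‖_{4/3} ≤ ‖f‖₂ ‖g‖₄`. -/
theorem eLpNorm_norm_mul_norm_le_two_four {f g : EuclideanSpace ℝ (Fin 3) → EuclideanSpace ℝ (Fin 3)}
    (hf : AEStronglyMeasurable f volume) (hg : AEStronglyMeasurable g volume) :
    eLpNorm (fun y => ‖f y‖ * ‖g y‖) (4 / 3) volume ≤ eLpNorm f 2 volume * eLpNorm g 4 volume := by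
  haveI := holderTriple_two_four
  have h := eLpNorm_le_eLpNorm_mul_eLpNorm_of_nnnorm (p := 2) (q := 4) (r := 4 / 3) hf hg
    (fun a b => ‖a‖ * ‖b‖) 1 (Eventually.of_forall fun x => by
      rw [one_mul]
      have : ‖‖f x‖ * ‖g x‖‖₊ = ‖f x‖₊ * ‖g x‖₊ := by rw [nnnorm_mul, nnnorm_norm, nnnorm_norm]
      rw [this])
  simpa using h

/-- `|f| |g| ∈ L^{4/3}` for `f ∈ L²`, `g ∈ L⁴`. -/
theorem memLp_norm_mul_norm_two_four {f g : EuclideanSpace ℝ (Fin 3) → EuclideanSpace ℝ (Fin 3)}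
    (hf : MemLp f 2 volume) (hg : MemLp g 4 volume) :
    MemLp (fun y => ‖f y‖ * ‖g y‖) (4 / 3) volume :=
  ⟨hf.1.norm.mul hg.1.norm, (eLpNorm_norm_mul_norm_le_two_four hf.1 hg.1).trans_lt
    (ENNReal.mul_lt_top hf.eLpNorm_lt_top hg.eLpNorm_lt_top)⟩

/-- A translate of an `L^p` field is `L^p` with the same norm. -/
theorem memLp_translate {w : EuclideanSpace ℝ (Fin 3) → EuclideanSpace ℝ (Fin 3)} {p : ℝ≥0∞}
    (hw : MemLp w p volume) (a : EuclideanSpace ℝ (Fin 3)) :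
    MemLp (fun y => w (a + y)) p volume ∧ eLpNorm (fun y => w (a + y)) p volume = eLpNorm w p volume :=
  ⟨hw.comp_measurePreserving (measurePreserving_add_left volume a),
    eLpNorm_comp_measurePreserving hw.1 (measurePreserving_add_left volume a)⟩

/-- **The `L^{4/3}` bound for a finite difference of the normalised pressure.** There is
`C < ∞` such that for every `w ∈ C⁴ ∩ L² ∩ L⁴` (vector field on `ℝ³`) and every step `a`:
`‖p̃[w](a + ·) − p̃[w]‖_{4/3} ≤ C ‖w‖₄ · ‖a‖ ‖Dw‖₂`
(translation covariance `p̃[w](a + ·) = p̃[w(a + ·)]`, the mixed-exponent difference bound for two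
Riesz-transform pressures, Hölder `L² × L⁴ → L^{4/3}`, and the translation estimate in `L²`).
[folklore, from Stein 1970 Ch. II §4.2 Thm 3] -/
theorem exists_eLpNorm_normalisedPressure_translate_sub_le :
    ∃ C : ℝ≥0∞, C ≠ ⊤ ∧ ∀ (w : EuclideanSpace ℝ (Fin 3) → EuclideanSpace ℝ (Fin 3)), ContDiff ℝ 4 w →
      MemLp w 2 volume → MemLp w 4 volume → ∀ a : EuclideanSpace ℝ (Fin 3),
        eLpNorm (fun x => normalisedPressure w (a + x) - normalisedPressure w x) (4 / 3) volume ≤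
          C * eLpNorm w 4 volume * (‖a‖ₑ * eLpNorm (fun x => fderiv ℝ w x) 2 volume) := by
  obtain ⟨C, hCt, hC⟩ := NormalisedPressureDifferenceMixed.exists_normalisedPressure_sub_memLp
    (P := 2) (r := 4 / 3) (by norm_num) ENNReal.ofNat_lt_top one_lt_fourThirds.1 one_lt_fourThirds.2
  refine ⟨3 * C, ENNReal.mul_ne_top (by norm_num) hCt, fun w hw h2 h4 a => ?_⟩
  have hwc : Continuous w := hw.continuous
  have h22 : (2 : ℝ≥0∞) * 2 = 4 := by norm_num
  -- the translate
  set wa : EuclideanSpace ℝ (Fin 3) → EuclideanSpace ℝ (Fin 3) := fun y => w (a + y) with hwa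
  have hwac : Continuous wa := hwc.comp (continuous_const.add continuous_id)
  obtain ⟨ha2, -⟩ := memLp_translate h2 a
  obtain ⟨ha4, ha4eq⟩ := memLp_translate h4 a
  -- hypotheses of the difference bound
  have hw_sq : MemLp (fun y => ‖w y‖ ^ 2) 2 volume := memLp_norm_sq_of_memLp_two_mul (by rwa [h22])
  have hwa_sq : MemLp (fun y => ‖wa y‖ ^ 2) 2 volume := memLp_norm_sq_of_memLp_two_mul (by rwa [h22])
  have hprod1 : MemLp (fun y => ‖wa y - w y‖ * ‖w y‖) (4 / 3) volume :=
    memLp_norm_mul_norm_two_four (ha2.sub h2) h4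
  have hprod2 : MemLp (fun y => ‖wa y - w y‖ * ‖wa y - w y‖) (4 / 3) volume :=
    memLp_norm_mul_norm_two_four (ha2.sub h2) (ha4.sub h4)
  obtain ⟨Q, -, hQae, hQ⟩ := hC wa w hwac.aestronglyMeasurable hwc.aestronglyMeasurable hwa_sq hw_sq hprod1 hprod2
  -- translation covariance of the normalised pressure
  have hcov : ∀ x, normalisedPressure w (a + x) = normalisedPressure wa x := fun x => by
    have h := normalisedPressure_comp_affine w a one_pos x
    simp only [one_smul] at h
    exact h.symm
  have hae : (fun x => normalisedPressure w (a + x) - normalisedPressure w x) =ᵐ[volume] Q := by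
    have : (fun x => normalisedPressure w (a + x) - normalisedPressure w x) =
        fun x => normalisedPressure wa x - normalisedPressure w x := funext fun x => by rw [hcov]
    rw [this]; exact hQae
  rw [eLpNorm_congr_ae hae]
  -- Hölder and the translation estimate
  have hd2 : eLpNorm (fun y => wa y - w y) 2 volume ≤ ‖a‖ₑ * eLpNorm (fun x => fderiv ℝ w x) 2 volume :=
    eLpNorm_sub_translate_le (hw.of_le (by norm_num)) a
  have hd4 : eLpNorm (fun y => wa y - w y) 4 volume ≤ 2 * eLpNorm w 4 volume := by
    calc eLpNorm (fun y => wa y - w y) 4 volume = eLpNorm (wa - w) 4 volume := rfl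
      _ ≤ eLpNorm wa 4 volume + eLpNorm w 4 volume :=
          eLpNorm_sub_le hwac.aestronglyMeasurable hwc.aestronglyMeasurable (by norm_num)
      _ = 2 * eLpNorm w 4 volume := by rw [ha4eq, two_mul]
  have hs : AEStronglyMeasurable (fun y => wa y - w y) volume := (hwac.sub hwc).aestronglyMeasurable
  have hb1 := eLpNorm_norm_mul_norm_le_two_four hs hwc.aestronglyMeasurable
  have hb2 := eLpNorm_norm_mul_norm_le_two_four hs hs
  calc eLpNorm Q (4 / 3) volume
      ≤ C * (eLpNorm (fun y => ‖wa y - w y‖ * ‖w y‖) (4 / 3) volume +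
          eLpNorm (fun y => ‖wa y - w y‖ * ‖wa y - w y‖) (4 / 3) volume) := hQ
    _ ≤ C * ((‖a‖ₑ * eLpNorm (fun x => fderiv ℝ w x) 2 volume) * eLpNorm w 4 volume +
          (‖a‖ₑ * eLpNorm (fun x => fderiv ℝ w x) 2 volume) * (2 * eLpNorm w 4 volume)) := by
        gcongr
        · exact hb1.trans (mul_le_mul' hd2 le_rfl)
        · exact hb2.trans (mul_le_mul' hd2 hd4)
    _ = 3 * C * eLpNorm w 4 volume * (‖a‖ₑ * eLpNorm (fun x => fderiv ℝ w x) 2 volume) := by ring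

/-! ### Fatou: the directional derivatives of the pressure -/

/-- The normalised pressure of a `C⁴ ∩ L²` field is `C²` (it is the pressure potential of
`PressureRepresentation`). -/
theorem contDiff_two_normalisedPressure {w : EuclideanSpace ℝ (Fin 3) → EuclideanSpace ℝ (Fin 3)}
    (hw : ContDiff ℝ 4 w) (h2 : MemLp w 2 volume) : ContDiff ℝ 2 (normalisedPressure w) := by
  have hL2 : Integrable fun y => ‖w y‖ ^ 2 := (memLp_two_iff_integrable_sq_norm h2.1).1 h2
  rw [normalisedPressure_eq_pressurePotential' (hw.of_le (by norm_num)) hL2]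
  exact contDiff_pressurePotential hw hL2

/-- **The `L^{4/3}` bound for the directional derivatives of the normalised pressure.** There is
`K < ∞` such that for every `w ∈ C⁴ ∩ L² ∩ L⁴` and every direction `e`:
`‖D p̃[w](·) e‖_{4/3} ≤ K ‖w‖₄ · ‖e‖ ‖Dw‖₂` (difference quotients along `e`, the fixed-step bound,
and Fatou's lemma in `L^{4/3}`). [folklore: Robinson–Rodrigo–Sadowski 2016, Lemma 5.1 (5.8)] -/
theorem exists_eLpNorm_fderiv_normalisedPressure_apply_le :
    ∃ K : ℝ≥0∞, K ≠ ⊤ ∧ ∀ (w : EuclideanSpace ℝ (Fin 3) → EuclideanSpace ℝ (Fin 3)), ContDiff ℝ 4 w →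
      MemLp w 2 volume → MemLp w 4 volume → ∀ e : EuclideanSpace ℝ (Fin 3),
        eLpNorm (fun x => fderiv ℝ (normalisedPressure w) x e) (4 / 3) volume ≤
          K * eLpNorm w 4 volume * (‖e‖ₑ * eLpNorm (fun x => fderiv ℝ w x) 2 volume) := by
  obtain ⟨C, hCt, hC⟩ := exists_eLpNorm_normalisedPressure_translate_sub_le
  refine ⟨C, hCt, fun w hw h2 h4 e => ?_⟩
  set q : EuclideanSpace ℝ (Fin 3) → ℝ := normalisedPressure w with hq
  have hq2 : ContDiff ℝ 2 q := contDiff_two_normalisedPressure hw h2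
  have hqc : Continuous q := hq2.continuous
  have hqd : Differentiable ℝ q := hq2.differentiable (by norm_num)
  -- the steps `h_n = 1/(n+1)` and the difference quotients
  set h : ℕ → ℝ := fun n => 1 / ((n : ℝ) + 1) with hh
  have hpos : ∀ n, 0 < h n := fun n => by rw [hh]; positivity
  set F : ℕ → EuclideanSpace ℝ (Fin 3) → ℝ := fun n x => (h n)⁻¹ • (q (h n • e + x) - q x) with hF
  have hFm : ∀ n, AEStronglyMeasurable (F n) volume := fun n => by
    have hc : Continuous (F n) :=
      ((hqc.comp (continuous_const.add continuous_id)).sub hqc).const_smul ((h n)⁻¹)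
    exact hc.aestronglyMeasurable
  -- pointwise convergence of the difference quotients to the directional derivative
  have hlim : ∀ x, Tendsto (fun n => F n x) atTop (𝓝 (fderiv ℝ q x e)) := by
    intro x
    have hl : HasDerivAt (fun t : ℝ => t • e + x) e 0 := by
      simpa using ((hasDerivAt_id (0 : ℝ)).smul_const e).add_const x
    have hg : HasDerivAt (q ∘ fun t : ℝ => t • e + x) (fderiv ℝ q x e) 0 :=
      (hqd x).hasFDerivAt.comp_hasDerivAt_of_eq 0 hl (by simp)
    have ht := hg.tendsto_slope_zero_right
    have hseq : Tendsto h atTop (𝓝[>] (0 : ℝ)) := by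
      refine tendsto_nhdsWithin_iff.2 ⟨?_, Eventually.of_forall fun n => hpos n⟩
      rw [hh]; exact tendsto_one_div_add_atTop_nhds_zero_nat
    have hcomp := ht.comp hseq
    refine hcomp.congr fun n => ?_
    simp [hF, Function.comp]
  -- Fatou in `L^{4/3}`
  have hFatou := Lp.eLpNorm_lim_le_liminf_eLpNorm (p := (4 / 3 : ℝ≥0∞)) hFm (fun x => fderiv ℝ q x e)
    (Eventually.of_forall hlim)
  refine hFatou.trans (liminf_le_of_frequently_le' (Eventually.of_forall fun n => ?_).frequently)
  -- the bound at step `n`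
  have hn0 : (h n) ≠ 0 := (hpos n).ne'
  have hstep := hC w hw h2 h4 (h n • e)
  have hsmul : F n = (h n)⁻¹ • fun x => q (h n • e + x) - q x := rfl
  rw [hsmul, eLpNorm_const_smul]
  calc ‖(h n)⁻¹‖ₑ * eLpNorm (fun x => q (h n • e + x) - q x) (4 / 3) volume
      ≤ ‖(h n)⁻¹‖ₑ * (C * eLpNorm w 4 volume * (‖h n • e‖ₑ * eLpNorm (fun x => fderiv ℝ w x) 2 volume)) := by
        gcongr
    _ = C * eLpNorm w 4 volume * ((‖(h n)⁻¹‖ₑ * ‖h n‖ₑ) * ‖e‖ₑ * eLpNorm (fun x => fderiv ℝ w x) 2 volume) := by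
        rw [enorm_smul]; ring
    _ = C * eLpNorm w 4 volume * (‖e‖ₑ * eLpNorm (fun x => fderiv ℝ w x) 2 volume) := by
        rw [enorm_inv hn0, ENNReal.inv_mul_cancel (by simpa using hn0) (enorm_ne_top), one_mul]

/-- `‖L‖ ≤ Σⱼ ‖L eⱼ‖` for a linear functional on `ℝ³` and the standard basis. -/
theorem opNorm_le_sum_norm_apply_single (L : EuclideanSpace ℝ (Fin 3) →L[ℝ] ℝ) :
    ‖L‖ ≤ ∑ j : Fin 3, ‖L (EuclideanSpace.single j 1)‖ := by
  refine ContinuousLinearMap.opNorm_le_bound _ (Finset.sum_nonneg fun j _ => norm_nonneg _) fun v => ?_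
  have hv : v = ∑ j : Fin 3, v j • EuclideanSpace.single j (1 : ℝ) := by
    simpa using ((EuclideanSpace.basisFun (Fin 3) ℝ).sum_repr v).symm
  calc ‖L v‖ = ‖L (∑ j : Fin 3, v j • EuclideanSpace.single j (1 : ℝ))‖ := by rw [← hv]
    _ = ‖∑ j : Fin 3, v j * L (EuclideanSpace.single j 1)‖ := by rw [map_sum]; simp only [map_smul, smul_eq_mul]
    _ ≤ ∑ j : Fin 3, ‖v j * L (EuclideanSpace.single j 1)‖ := norm_sum_le _ _
    _ ≤ ∑ j : Fin 3, ‖L (EuclideanSpace.single j 1)‖ * ‖v‖ := by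
        refine Finset.sum_le_sum fun j _ => ?_
        rw [norm_mul, mul_comm]
        gcongr
        exact PiLp.norm_apply_le v j
    _ = (∑ j : Fin 3, ‖L (EuclideanSpace.single j 1)‖) * ‖v‖ := by rw [Finset.sum_mul]

/-- **The `L^{4/3}` bound for the full derivative of the normalised pressure** (section form):
`‖D p̃[w]‖_{4/3} ≤ 3K ‖w‖₄ ‖Dw‖₂` for `w ∈ C⁴ ∩ L² ∩ L⁴`. [folklore: RRS2016 Lemma 5.1 (5.8)] -/
theorem exists_eLpNorm_fderiv_normalisedPressure_le :
    ∃ K : ℝ≥0∞, K ≠ ⊤ ∧ ∀ (w : EuclideanSpace ℝ (Fin 3) → EuclideanSpace ℝ (Fin 3)), ContDiff ℝ 4 w →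
      MemLp w 2 volume → MemLp w 4 volume →
        eLpNorm (fun x => fderiv ℝ (normalisedPressure w) x) (4 / 3) volume ≤
          K * eLpNorm w 4 volume * eLpNorm (fun x => fderiv ℝ w x) 2 volume := by
  obtain ⟨K, hKt, hK⟩ := exists_eLpNorm_fderiv_normalisedPressure_apply_le
  refine ⟨3 * K, ENNReal.mul_ne_top (by norm_num) hKt, fun w hw h2 h4 => ?_⟩
  have hq2 : ContDiff ℝ 2 (normalisedPressure w) := contDiff_two_normalisedPressure hw h2
  have hDc : Continuous fun x => fderiv ℝ (normalisedPressure w) x := hq2.continuous_fderiv (by norm_num)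
  have hjm : ∀ j : Fin 3, AEStronglyMeasurable
      (fun x => fderiv ℝ (normalisedPressure w) x (EuclideanSpace.single j 1)) volume := fun j =>
    (hDc.clm_apply continuous_const).aestronglyMeasurable
  have hj : ∀ j : Fin 3, eLpNorm (fun x => fderiv ℝ (normalisedPressure w) x (EuclideanSpace.single j 1)) (4 / 3) volume ≤
      K * eLpNorm w 4 volume * eLpNorm (fun x => fderiv ℝ w x) 2 volume := fun j => by
    have h := hK w hw h2 h4 (EuclideanSpace.single j 1)
    have h1 : ‖(EuclideanSpace.single j (1 : ℝ) : EuclideanSpace ℝ (Fin 3))‖ₑ = 1 := by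
      rw [← ofReal_norm]; simp
    rwa [h1, one_mul] at h
  -- pointwise domination by the sum of the directional derivatives
  have hdom : eLpNorm (fun x => fderiv ℝ (normalisedPressure w) x) (4 / 3) volume ≤
      eLpNorm (fun x => ∑ j : Fin 3, ‖fderiv ℝ (normalisedPressure w) x (EuclideanSpace.single j 1)‖) (4 / 3) volume := by
    exact eLpNorm_mono_real fun x => opNorm_le_sum_norm_apply_single _
  have hsum : eLpNorm (fun x => ∑ j : Fin 3, ‖fderiv ℝ (normalisedPressure w) x (EuclideanSpace.single j 1)‖) (4 / 3) volume ≤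
      ∑ j : Fin 3, eLpNorm (fun x => ‖fderiv ℝ (normalisedPressure w) x (EuclideanSpace.single j 1)‖) (4 / 3) volume := by
    have h := eLpNorm_sum_le (s := Finset.univ) (μ := volume) (p := (4 / 3 : ℝ≥0∞))
      (f := fun (j : Fin 3) (x : EuclideanSpace ℝ (Fin 3)) => ‖fderiv ℝ (normalisedPressure w) x (EuclideanSpace.single j 1)‖)
      (fun j _ => (hjm j).norm) one_lt_fourThirds.1.le
    have hfun : (fun x => ∑ j : Fin 3, ‖fderiv ℝ (normalisedPressure w) x (EuclideanSpace.single j 1)‖) =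
        ∑ j : Fin 3, fun x => ‖fderiv ℝ (normalisedPressure w) x (EuclideanSpace.single j 1)‖ := by
      funext x; simp only [Finset.sum_apply]
    rw [hfun]; exact h
  calc eLpNorm (fun x => fderiv ℝ (normalisedPressure w) x) (4 / 3) volume
      ≤ ∑ j : Fin 3, eLpNorm (fun x => ‖fderiv ℝ (normalisedPressure w) x (EuclideanSpace.single j 1)‖) (4 / 3) volume :=
        hdom.trans hsum
    _ = ∑ j : Fin 3, eLpNorm (fun x => fderiv ℝ (normalisedPressure w) x (EuclideanSpace.single j 1)) (4 / 3) volume := by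
        simp_rw [eLpNorm_norm]
    _ ≤ ∑ _j : Fin 3, K * eLpNorm w 4 volume * eLpNorm (fun x => fderiv ℝ w x) 2 volume :=
        Finset.sum_le_sum fun j _ => hj j
    _ = 3 * K * eLpNorm w 4 volume * eLpNorm (fun x => fderiv ℝ w x) 2 volume := by
        rw [Finset.sum_const, Finset.card_univ, Fintype.card_fin]; ring

end Pressure

/-- **The `L^{4/3}` bound for the gradient of the normalised pressure** (registered closed form,
sub-goal `eLpNorm_fderiv_normalisedPressure_le` of stmt-NavierStokesRegularity-16855): there is a
universal `K < ∞` such that for every vector field `w ∈ C⁴(ℝ³) ∩ L² ∩ L⁴`,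
`‖D p̃[w]‖_{L^{4/3}} ≤ K ‖w‖_{L⁴} ‖Dw‖_{L²}` — the Calderón–Zygmund input of the flux variation
bound (`∫ |u| |∇p| ≤ ‖u‖₄ ‖∇p‖_{4/3} ≤ K ‖u‖₄² ‖∇u‖₂`). Unconditional: proved from the tree's
Calderón–Zygmund bound for the difference of two Riesz-transform pressures
(`exists_normalisedPressure_sub_memLp`) by difference quotients and Fatou.
[folklore: Stein 1970, Ch. II §4.2 Thm 3; Robinson–Rodrigo–Sadowski 2016, Lemma 5.1 (5.8)] -/
theorem eLpNorm_fderiv_normalisedPressure_le : ∃ K : ℝ≥0∞, K ≠ ⊤ ∧ ∀ (w : EuclideanSpace ℝ (Fin 3) → EuclideanSpace ℝ (Fin 3)), ContDiff ℝ 4 w → MeasureTheory.MemLp w 2 MeasureTheory.volume → MeasureTheory.MemLp w 4 MeasureTheory.volume → MeasureTheory.eLpNorm (fun x => fderiv ℝ (Literature.Analysis.FluidPDE.normalisedPressure w) x) (4 / 3) MeasureTheory.volume ≤ K * MeasureTheory.eLpNorm w 4 MeasureTheory.volume * MeasureTheory.eLpNorm (fun x => fderiv ℝ w x) 2 MeasureTheory.volume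 :=
  exists_eLpNorm_fderiv_normalisedPressure_le

end Summit.NavierStokesRegularity.NavierStokesRegularity.Theorems.PlanarEnergyAPriori

end
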